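import Summits.BirchSwinnertonDyer.BirchSwinnertonDyer.Theorems.ErratumRoadFiveBdvCalibrationSplitCalibratorDefs
import HarnessLib

/-!
# The BDV-calibration split of `A♭-fam` ON THE AMENDED EXPONENT `R` (S1R, TOTIENT spelling (α)) — RDefs
# (crux stmt-BirchSwinnertonDyer-19715, (α2) item stmt-BirchSwinnertonDyer-33169 `ErratumRoadFive.KatoValuationIneqNonsplitAtFive`)

LEAD `bsd-line-er5-p1` g20, pen word `d2R` P1 (bsd-stepL STATUS 2026-08-31T03:03:23Z; basis: typer ty-snf g1
`T0′: (P-T0)′ CONFIRMED` 02:53:02Z, memo `pub/bsd-stepL/ty-snf/g1/T0PRIME-MEMO.md`; idea-9 memo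
`Cruxes/EulerHalfNotRamNoInertSetAtFive/Lines/bdv22_o4_erho_level.md` rev 1.4 CONCURS; dispute «T0ι» resolved by concession).
FINDING OF RECORD: BDV22's unit `A = L_p(f_α,g)/(L_p(f_α)L_p(f_α⊗ε_K))` ((30), p. 36–37) carries the Petersson norm on
`Γ₁(N_f)` (KLZ17 Thm. 2.7.4), while the registered frame books `Γ₀(N)` objects (`congruenceNumber` on `Gamma0 N`, the
`X₀(N)` modular degree and symbol lattice); the index `ι_N = [Γ₀(N) : ±Γ₁(N)] = φ(N)/2` is booked NOWHERE in the typed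
exponent `bdvExplicitExponent`, so S1 AS TYPED (`ErratumRoadFiveBdvCalibrationSplit.BdvChainExplicitNonsplit`, with an
`f`-blind shift `V p d_L`) is short by `ν(W) := v_p φ(N)` on `{W : p ∣ φ(N)}` and exact elsewhere.  REPAIR (α), pen's call:
keep the Γ₀ pair and subtract `v_p φ(N)` ONCE, `N` = the level binder of the Kato newform `f : CuspForm (Gamma0 N) 2`
(`v_p φ(N) = v_p φ(N/p)` at `p ∥ N`, `p ≥ 5`); zero definition requests.

This file (kind definition; originals UNTOUCHED — superseded, not refuted):
* §1 idea-9's typed R exponent VERBATIM from `Cruxes/EulerHalfNotRamNoInertSetAtFive/Lines/bdv_explicit_exponent_R_Sketch.lean`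
  rev 1.2 (sha16 `76cb0edb1f260350`): `petIndexVal`, `bdvExplicitExponentR … N := bdvExplicitExponent … − petIndexVal p N`,
  `bdvExplicitExponentR_eq_of_not_dvd`, `bdvExplicitExponent_gamma1_reading`, `bdvExplicitExponentR_sub` (its
  `native_decide` sanity `example` is dropped — hygiene), plus `bdvExplicitExponentR_of_not_split` (`a_p = −1`);
* §2 the R statements, each = its d1land original (`Theorems/ErratumRoadFiveBdvCalibrationSplit{Defs,CalibratorDefs}.lean`,
  p782094 / p782155) VERBATIM with `bdvExplicitExponent …` ↦ `bdvExplicitExponentR … N`: S1R `BdvChainExplicitNonsplitR`,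
  S2R `EisensteinPeriodRatioValuationR L p`, S2bR `BstwIntegralPerrinRiouGoodOrdinaryR` (S2a `CalibratorSupply` and S2c
  `CalibratorDataRealisable` are exponent-free and IMPORTED); S2 must move with S1 — with S2 unamended the glue's
  calibration step would pin `V p d_L = −ν(N′)` of the calibrator instead of `0`;
* §3 `AFlatFamStatementR` = `AFlatFamStatement` (= registered A♭-fam text) with `− (padicValNat p (Nat.totient N) : ℤ)`
  inserted right after the Γ₀ pair (d1land Defs l.330–333 amended alike, TOTIENT spelling).
All five statements are `@[conjecture]` (cell RULING 75: OPEN, nothing asserted).  The glue on R is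
`ErratumRoadFiveBdvCalibrationSplitR`; the BY-NAME composition A♭-famR → `KatoValuationIneqNonsplitAtFive` (the ν-free crux,
reached with slack `ν ≥ 0`) is `ErratumRoadFiveBstwDoorValuationIneqR`.

Sources: [BDV22] Bertolini–Darmon–Venerucci, Adv. Math. 398 (2022) 108172, §4 (30), (38).  [KLZ17] Kings–Loeffler–Zerbes,
Camb. J. Math. 5 (2017) Thm. 2.7.4.  [BSTW24] arXiv:2409.01350 Lemma 1.6, Rem. 1.7, Prop. 4.13.  [ARS12] Agashe–Ribet–Stein
Thm. 2.1.  [Tilouine97] (CSS) Thm. 3.4.  Typed ≠ proved; no summit statement is touched; BSD is proved for no curve.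
-/

set_option autoImplicit false
-- D-0017: single-problem summit, so `Summit.BirchSwinnertonDyer.BirchSwinnertonDyer.…` repeats a namespace BY DESIGN.
set_option linter.dupNamespace false

noncomputable section

open scoped Classical NumberField TensorProduct BigOperators

namespace Summit.BirchSwinnertonDyer.BirchSwinnertonDyer.Theorems.ErratumRoadFiveBdvCalibrationSplitR

open Field
open Literature.NumberTheory.GaloisRepresentations
open Literature.NumberTheory.EllipticCurves Literature.NumberTheory.EllipticCurves.Kato2004
open Literature.NumberTheory.EllipticCurves.Kato2004.EulerSystemValues
open Literature.NumberTheory.EllipticCurves.Rank1Residual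
open Literature.NumberTheory.EllipticCurves.Rank1Residual.Typed
open Literature.NumberTheory.EllipticCurves.ModularForms
open Literature.NumberTheory.EllipticCurves.Castella2018
open Summit.BirchSwinnertonDyer.Rank1Residual
open Summit.BirchSwinnertonDyer.BirchSwinnertonDyer.Theorems.ErratumRoadFiveBdvCalibrationSplit
open IsDedekindDomain (HeightOneSpectrum)
open CongruenceSubgroup (Gamma0)

/-! ## §1 The amended exponent (idea-9 g51, `Lines/bdv_explicit_exponent_R_Sketch.lean` rev 1.2, verbatim) -/

/-- `ν_p(N) := v_p(φ(N))` — the `p`-adic valuation of the Petersson index `[Γ₀(N) : ±Γ₁(N)] = φ(N)/2` (`p` odd).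
[cite: KingsLoefflerZerbes2017, Thm. 2.7.4] -/
def petIndexVal (p N : ℕ) : ℕ := padicValNat p (Nat.totient N)

/-- The amended explicit crossing exponent (S1R, option (α) of the memo): the registered `bdvExplicitExponent`
minus the Γ₁/Γ₀ Petersson-index valuation `v_p(φ(N))` of the conductor `N`.
[cite: BertoliniDarmonVenerucci2022, §4 (30) and (38), p. 36–37 and 44] [cite: KingsLoefflerZerbes2017, Thm. 2.7.4] -/
def bdvExplicitExponentR (p : ℕ) (ap c : ℤ) (s : ℚ) (k : ℤ) (rf m : ℕ) (v : ℤ) (N : ℕ) : ℤ :=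
  bdvExplicitExponent p ap c s k rf m v - (petIndexVal p N : ℤ)

/-- On the sub-class `p ∤ φ(N)` (no bad prime `q ≡ 1 (mod p)`; option (β) of the memo) the amendment vanishes. -/
theorem bdvExplicitExponentR_eq_of_not_dvd (p : ℕ) (ap c : ℤ) (s : ℚ) (k : ℤ) (rf m : ℕ) (v : ℤ) (N : ℕ)
    (hN : ¬ p ∣ Nat.totient N) :
    bdvExplicitExponentR p ap c s k rf m v N = bdvExplicitExponent p ap c s k rf m v := by
  simp [bdvExplicitExponentR, petIndexVal, padicValNat.eq_zero_of_not_dvd hN]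

/-- The `Γ₁`-reading: booking `r_f · φ(N)` (a stand-in for the `Γ₁(N)`-congruence number up to `p`-units, `p ≥ 5`)
in place of `r_f` in the registered exponent IS the amended exponent. [cite: AgasheRibetStein2012, Thm. 2.1] -/
theorem bdvExplicitExponent_gamma1_reading (p : ℕ) [hp : Fact p.Prime] (ap c : ℤ) (s : ℚ) (k : ℤ)
    (rf m : ℕ) (v : ℤ) (N : ℕ) (hrf : rf ≠ 0) (hφ : Nat.totient N ≠ 0) :
    bdvExplicitExponent p ap c s k (rf * Nat.totient N) m v = bdvExplicitExponentR p ap c s k rf m v N := by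
  simp only [bdvExplicitExponentR, bdvExplicitExponent, petIndexVal, padicValNat.mul hrf hφ]
  push_cast
  ring

/-- The column-difference form (P-T0)′ of the memo, as pure bookkeeping: for two parameter tuples the amended
exponents differ from the registered ones by exactly `−(ν_p(N) − ν_p(N'))`. -/
theorem bdvExplicitExponentR_sub (p : ℕ) (ap ap' c c' : ℤ) (s s' : ℚ) (k k' : ℤ) (rf rf' m m' : ℕ)
    (v v' : ℤ) (N N' : ℕ) :
    bdvExplicitExponentR p ap c s k rf m v N - bdvExplicitExponentR p ap' c' s' k' rf' m' v' N' =
      (bdvExplicitExponent p ap c s k rf m v - bdvExplicitExponent p ap' c' s' k' rf' m' v') -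
        ((petIndexVal p N : ℤ) - petIndexVal p N') := by
  simp only [bdvExplicitExponentR]
  ring

/-- At a prime `p ≥ 5` of NON-SPLIT multiplicative reduction (`a_p = −1`, [KO92, Lemme 1]) the amended exponent is the
A♭-famR exponent: the registered A♭-fam exponent with `− v_p φ(N)` right after the Γ₀ pair (TOTIENT spelling (α)).
[cite: KrausOesterle1992, §3 Lemme 1, p. 262] -/
theorem bdvExplicitExponentR_of_not_split (W : WeierstrassCurve ℚ) [W.IsElliptic] (p : ℕ) [Fact p.Prime]
    (hm : Mult W p) (hns : ¬ W.HasSplitMultiplicativeReductionAtPrime p) (h5 : 5 ≤ p)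
    (c : ℤ) (s : ℚ) (k : ℤ) (rf m : ℕ) (v : ℤ) (N : ℕ) :
    bdvExplicitExponentR p (W.LFunction p) c s k rf m v N =
      1 + padicValInt p c - padicValRat p s - padicValInt p k - ((padicValNat p rf : ℤ) - padicValNat p m) -
        (padicValNat p (Nat.totient N) : ℤ) - v := by
  rw [bdvExplicitExponentR, bdvExplicitExponent_of_not_split W p hm hns h5, petIndexVal]
  ring

/-! ## §2 The R statements (d1land S1 ∕ S2 ∕ S2b verbatim with `bdvExplicitExponent …` ↦ `bdvExplicitExponentR … N`) -/

/-- **S1R — `BdvChainExplicitNonsplitR`: BDV22 (38) valued up to its `(K,p)`-constant, ON THE AMENDED EXPONENT** —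
`ErratumRoadFiveBdvCalibrationSplit.BdvChainExplicitNonsplit` verbatim (one `f`-blind shift `V p d_L` over the whole
`p`-non-exceptional rank-one class) with the Γ₁/Γ₀ Petersson index booked ONCE: exponent `bdvExplicitExponentR … N − V p d_L`,
`N` the level of the Kato newform `f`.  Why it might fail: as S1 (c1: no integral Thm. 3.1 in print; c3: frozen-`β` at
`p`-new weight); the index slip of S1 is repaired here (typer T0′, idea-9 rev 1.4).
[cite: BertoliniDarmonVenerucci2022, §4 (30), (38) and Lemma 4.6, p. 36–37, 44–45] [cite: KingsLoefflerZerbes2017, Thm. 2.7.4] -/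
@[conjecture]
def BdvChainExplicitNonsplitR : Prop :=
  ∃ V : ℕ → ℤ → ℤ,
    ∀ (W : WeierstrassCurve ℚ) [W.IsElliptic] [W.IsGloballyMinimal] (p : ℕ) [Fact p.Prime]
      [ContinuousSMul ℤ_[p] (W.tateModule p)] [Module.Free ℤ_[p] (W.tateModule p)]
      [Module.Finite ℤ_[p] (W.tateModule p)] [NeZero (W.conductorNorm ℤ)],
      NonExceptionalRankOneAt W p → 5 ≤ p → Surj W p →
      ∀ (L : Type) [Field L] [NumberField L], IsImaginaryQuadratic L →
        SatisfiesHeegnerHypothesis (W.conductorNorm ℤ) L → SatisfiesHeegnerHypothesis p L →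
        NumberField.discr L < -4 → Odd (NumberField.discr L) →
        (W.quadraticTwist (NumberField.discr L : ℚ)).entireLFunction 1 ≠ 0 →
      ∀ (Dt : ModularParametrizationData W (W.conductorNorm ℤ))
        (Hd : HeegnerDatum (W.conductorNorm ℤ) (NumberField.discr L)) (w₀ : NumberField.InfinitePlace L)
        (PL : (W.baseChange L).toAffine.Point),
        WeierstrassCurve.Affine.Point.map w₀.embedding.toRatAlgHom PL = heegnerPointComplex Dt Hd →
        ¬ (p : ℤ) ∣ Dt.c →
      ∀ (s : ℚ) (k : ℤ),
        (Real.sqrt ((NumberField.discr L).natAbs : ℝ) : ℂ) *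
            (W.quadraticTwist (NumberField.discr L : ℚ)).entireLFunction 1 = (s : ℂ) * (minusPeriod Dt.f : ℂ) →
        (Dt.c : ℝ) * minusPeriod Dt.f = k * W.imaginaryPeriodRat →
      ∀ (W' : WeierstrassCurve ℚ) [W'.IsElliptic] (D : ModularParametrizationData W' (W.conductorNorm ℤ)),
        D.f = Dt.f →
        (∀ (W'' : WeierstrassCurve ℚ) [W''.IsElliptic] (D'' : ModularParametrizationData W'' (W.conductorNorm ℤ)),
            D''.f = D.f → D.modularDegree ≤ D''.modularDegree) →
      ∀ (K : ZpExtension ℚ p) (hK : K.IsCyclotomic) (γ : absoluteGaloisGroup ℚ)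
        (I : IwasawaH1Data W p K γ), K.IsTopGenerator γ →
      ∀ (hp : p ≠ 2) (N : ℕ) [NeZero N] (f : CuspForm (Gamma0 N) 2), IsNewformOf W f →
      ∀ (ι : (n : ℕ) → (CyclotomicField n ℚ →+* ℂ)) (q : ℚ)
        (Λ : ∀ (m : ℕ) (r : Finset (HeightOneSpectrum (𝓞 ℚ))),
          H1 (tateRep W p) (cycSubgroup p m r) →ₗ[ℤ_[p]] ℚ_[p] ⊗[ℚ] CyclotomicField (cycLevel p m r) ℚ)
        (c d₁ a : ℤ) (A : ℕ) (d' : ℤ)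
        (z : ∀ (m : ℕ) (r : (cyclotomicLevelsRat p (badPlaces c d₁ A N)).Ideals),
          H1 (tateRep W p) ((cyclotomicLevelsRat p (badPlaces c d₁ A N)).level m r.1))
        (x : ∀ (m : ℕ) (r : (cyclotomicLevelsRat p (badPlaces c d₁ A N)).Ideals),
          CyclotomicField (cycLevel p m r.1) ℚ)
        (y : I.H) (perRatio : ℚ),
        q ≠ 0 → ZetaBody W p f ι ((q : ℚ) : ℝ) Λ c d₁ a A z x →
        (∀ n : ℕ, I.proj n y =
          levelToLayer W p hK hp (badPlaces c d₁ A N) n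
            (z (n + 1) (cyclotomicLevelsRat p (badPlaces c d₁ A N)).idealOne)) →
        0 < A → Int.gcd c (6 * p * A) = 1 → Int.gcd d₁ (6 * p * N) = 1 → (d₁ : ℤ) * d' ≡ 1 [ZMOD (A : ℤ)] →
        ratCuspFactor f true c d₁ a A d' ≠ 0 → perRatio ≠ 0 →
        plusPeriod f = ((perRatio : ℚ) : ℝ) * W.realPeriodRat →
      ∀ (ι' : PadicAlgCl p ≃+* ℂ)
        (κ : ZpExtension L p) (γ' : absoluteGaloisGroup L) (ΩK : ℂ) (Ωp : (unrIntegers p)ˣ) (Λf : UnrSeries p),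
        κ.IsAnticyclotomic → κ.IsTopGenerator γ' → ΩK ≠ 0 →
        IsBDPLFunction ι' (X11b.primeOfEmbeddingDatum p ι' w₀.embedding) κ γ' Dt.f ΩK
          ((Ωp : unrIntegers p) : ℂ_[p]) Λf →
      ∀ (X : ℂ_[p]), Λf.HasValueAt 0 X →
      ∀ σ : ℚ_[p], HasLocPKummerLog W p (bottomClass W p K I y) σ → σ ≠ 0 →
        ‖X‖ = (p : ℝ) ^ (bdvExplicitExponentR p (W.LFunction p) Dt.c s k (congruenceNumber Dt.f) D.modularDegree
            (σ.valuation + padicValRat p (perRatio /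
              (q * ratCuspFactor f true c d₁ a A d' * ∏ ℓ ∈ A.primeFactors.erase p, eulerFactorAtOne W N ℓ))) N -
            V p (NumberField.discr L))

/-- **S2R — `EisensteinPeriodRatioValuationR L p`: a CALIBRATOR exists at `(L, p)`, exact ON THE AMENDED EXPONENT** —
`ErratumRoadFiveBdvCalibrationSplit.EisensteinPeriodRatioValuation` verbatim with exponent `bdvExplicitExponentR … N`
(the calibrator's own `− v_p φ(N′)`).  Finer split: `CalibratorSupply L p` (imported) ∧ `CalibratorDataRealisable`
(imported) ∧ `BstwIntegralPerrinRiouGoodOrdinaryR` ⟹ this (`ErratumRoadFiveBdvCalibrationSplitR`).  Why it might fail: as S2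
(supply for a prescribed `L`; the port's integrality at primes dividing `u_L`).
[cite: BurungaleSkinnerTianWan2024, Thm. 1.13 and §6.2.1 (86)–(94), p. 60] [cite: BertoliniDarmonVenerucci2022, §4 (38), p. 44] -/
@[conjecture]
def EisensteinPeriodRatioValuationR (L : Type) [Field L] [NumberField L] (p : ℕ) [Fact p.Prime] : Prop :=
  ∃ (W : WeierstrassCurve ℚ) (_ : W.IsElliptic) (_ : W.IsGloballyMinimal)
    (_ : ContinuousSMul ℤ_[p] (W.tateModule p)) (_ : Module.Free ℤ_[p] (W.tateModule p))
    (_ : Module.Finite ℤ_[p] (W.tateModule p)) (_ : NeZero (W.conductorNorm ℤ)),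
    W.analyticRank = 1 ∧ Irr W p ∧ GoodOrd W p ∧ Surj W p ∧
    SatisfiesHeegnerHypothesis (W.conductorNorm ℤ) L ∧
    (W.quadraticTwist (NumberField.discr L : ℚ)).entireLFunction 1 ≠ 0 ∧
    ∃ (Dt : ModularParametrizationData W (W.conductorNorm ℤ))
      (Hd : HeegnerDatum (W.conductorNorm ℤ) (NumberField.discr L)) (w₀ : NumberField.InfinitePlace L)
      (PL : (W.baseChange L).toAffine.Point),
      WeierstrassCurve.Affine.Point.map w₀.embedding.toRatAlgHom PL = heegnerPointComplex Dt Hd ∧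
      ¬ (p : ℤ) ∣ Dt.c ∧
    ∃ (s : ℚ) (k : ℤ),
      (Real.sqrt ((NumberField.discr L).natAbs : ℝ) : ℂ) *
          (W.quadraticTwist (NumberField.discr L : ℚ)).entireLFunction 1 = (s : ℂ) * (minusPeriod Dt.f : ℂ) ∧
      (Dt.c : ℝ) * minusPeriod Dt.f = k * W.imaginaryPeriodRat ∧
    ∃ (W' : WeierstrassCurve ℚ) (_ : W'.IsElliptic) (D : ModularParametrizationData W' (W.conductorNorm ℤ)),
      D.f = Dt.f ∧
      (∀ (W'' : WeierstrassCurve ℚ) [W''.IsElliptic] (D'' : ModularParametrizationData W'' (W.conductorNorm ℤ)),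
          D''.f = D.f → D.modularDegree ≤ D''.modularDegree) ∧
    ∃ (K : ZpExtension ℚ p) (hK : K.IsCyclotomic) (γ : absoluteGaloisGroup ℚ)
      (I : IwasawaH1Data W p K γ), K.IsTopGenerator γ ∧
    ∃ (hp : p ≠ 2) (N : ℕ) (_ : NeZero N) (f : CuspForm (Gamma0 N) 2), IsNewformOf W f ∧
    ∃ (ι : (n : ℕ) → (CyclotomicField n ℚ →+* ℂ)) (q : ℚ)
      (Λ : ∀ (m : ℕ) (r : Finset (HeightOneSpectrum (𝓞 ℚ))),
        H1 (tateRep W p) (cycSubgroup p m r) →ₗ[ℤ_[p]] ℚ_[p] ⊗[ℚ] CyclotomicField (cycLevel p m r) ℚ)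
      (c d₁ a : ℤ) (A : ℕ) (d' : ℤ)
      (z : ∀ (m : ℕ) (r : (cyclotomicLevelsRat p (badPlaces c d₁ A N)).Ideals),
        H1 (tateRep W p) ((cyclotomicLevelsRat p (badPlaces c d₁ A N)).level m r.1))
      (x : ∀ (m : ℕ) (r : (cyclotomicLevelsRat p (badPlaces c d₁ A N)).Ideals),
        CyclotomicField (cycLevel p m r.1) ℚ)
      (y : I.H) (perRatio : ℚ),
      q ≠ 0 ∧ ZetaBody W p f ι ((q : ℚ) : ℝ) Λ c d₁ a A z x ∧
      (∀ n : ℕ, I.proj n y =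
        levelToLayer W p hK hp (badPlaces c d₁ A N) n
          (z (n + 1) (cyclotomicLevelsRat p (badPlaces c d₁ A N)).idealOne)) ∧
      0 < A ∧ Int.gcd c (6 * p * A) = 1 ∧ Int.gcd d₁ (6 * p * N) = 1 ∧ (d₁ : ℤ) * d' ≡ 1 [ZMOD (A : ℤ)] ∧
      ratCuspFactor f true c d₁ a A d' ≠ 0 ∧ perRatio ≠ 0 ∧
      plusPeriod f = ((perRatio : ℚ) : ℝ) * W.realPeriodRat ∧
    ∃ (ι' : PadicAlgCl p ≃+* ℂ)
      (κ : ZpExtension L p) (γ' : absoluteGaloisGroup L) (ΩK : ℂ) (Ωp : (unrIntegers p)ˣ) (Λf : UnrSeries p),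
      κ.IsAnticyclotomic ∧ κ.IsTopGenerator γ' ∧ ΩK ≠ 0 ∧
      IsBDPLFunction ι' (X11b.primeOfEmbeddingDatum p ι' w₀.embedding) κ γ' Dt.f ΩK
        ((Ωp : unrIntegers p) : ℂ_[p]) Λf ∧
    ∃ (X : ℂ_[p]), Λf.HasValueAt 0 X ∧
    ∃ σ : ℚ_[p], HasLocPKummerLog W p (bottomClass W p K I y) σ ∧ σ ≠ 0 ∧
      ‖X‖ = (p : ℝ) ^ (bdvExplicitExponentR p (W.LFunction p) Dt.c s k (congruenceNumber Dt.f) D.modularDegree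
          (σ.valuation + padicValRat p (perRatio /
            (q * ratCuspFactor f true c d₁ a A d' * ∏ ℓ ∈ A.primeFactors.erase p, eulerFactorAtOne W N ℓ))) N)

/-- **S2bR — `BstwIntegralPerrinRiouGoodOrdinaryR`: BSTW's integral Perrin-Riou formula at a GOOD ORDINARY prime, crossed with
BDP and the Gross–Zagier descent, exact ON THE AMENDED EXPONENT** — `ErratumRoadFiveBdvCalibrationSplit.BstwIntegralPerrinRiouGoodOrdinary`
verbatim with exponent `bdvExplicitExponentR … N` (at good `p`, BSTW24 Prop. 4.13 (ii) + Thm. 4.10 + Rem. 1.7 give the same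
index count: `A = unit/c̃^{Γ₁}_g`, `c̃_g ∼ ι_N · m^{X₀}` — typer T0′).  Why it might fail: the one transcription risk of S2b
(`Γ₀` vs a `p`-stabilised congruence number at good `p`).
[cite: BurungaleSkinnerTianWan2024, Thm. 1.13, Prop. 4.13, Rem. 1.7, §6.2.1 (86)–(94), p. 43, 59–60] [cite: Kato2004Asterisque, Thm. 12.5 (1), p. 229] -/
@[conjecture]
def BstwIntegralPerrinRiouGoodOrdinaryR : Prop :=
  ∀ (W : WeierstrassCurve ℚ) [W.IsElliptic] [W.IsGloballyMinimal] (p : ℕ) [Fact p.Prime]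
    [ContinuousSMul ℤ_[p] (W.tateModule p)] [Module.Free ℤ_[p] (W.tateModule p)]
    [Module.Finite ℤ_[p] (W.tateModule p)] [NeZero (W.conductorNorm ℤ)],
    W.analyticRank = 1 → Irr W p → GoodOrd W p → 5 ≤ p → Surj W p →
    ∀ (L : Type) [Field L] [NumberField L], IsImaginaryQuadratic L →
      SatisfiesHeegnerHypothesis (W.conductorNorm ℤ) L → SatisfiesHeegnerHypothesis p L →
      NumberField.discr L < -4 → Odd (NumberField.discr L) →
      (W.quadraticTwist (NumberField.discr L : ℚ)).entireLFunction 1 ≠ 0 →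
      ∀ (Dt : ModularParametrizationData W (W.conductorNorm ℤ))
        (Hd : HeegnerDatum (W.conductorNorm ℤ) (NumberField.discr L)) (w₀ : NumberField.InfinitePlace L)
        (PL : (W.baseChange L).toAffine.Point),
        WeierstrassCurve.Affine.Point.map w₀.embedding.toRatAlgHom PL = heegnerPointComplex Dt Hd →
        ¬ (p : ℤ) ∣ Dt.c →
      ∀ (s : ℚ) (k : ℤ),
        (Real.sqrt ((NumberField.discr L).natAbs : ℝ) : ℂ) *
            (W.quadraticTwist (NumberField.discr L : ℚ)).entireLFunction 1 = (s : ℂ) * (minusPeriod Dt.f : ℂ) →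
        (Dt.c : ℝ) * minusPeriod Dt.f = k * W.imaginaryPeriodRat →
      ∀ (W' : WeierstrassCurve ℚ) [W'.IsElliptic] (D : ModularParametrizationData W' (W.conductorNorm ℤ)),
        D.f = Dt.f →
        (∀ (W'' : WeierstrassCurve ℚ) [W''.IsElliptic] (D'' : ModularParametrizationData W'' (W.conductorNorm ℤ)),
            D''.f = D.f → D.modularDegree ≤ D''.modularDegree) →
      ∀ (K : ZpExtension ℚ p) (hK : K.IsCyclotomic) (γ : absoluteGaloisGroup ℚ)
        (I : IwasawaH1Data W p K γ), K.IsTopGenerator γ →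
      ∀ (hp : p ≠ 2) (N : ℕ) [NeZero N] (f : CuspForm (Gamma0 N) 2), IsNewformOf W f →
      ∀ (ι : (n : ℕ) → (CyclotomicField n ℚ →+* ℂ)) (q : ℚ)
        (Λ : ∀ (m : ℕ) (r : Finset (HeightOneSpectrum (𝓞 ℚ))),
          H1 (tateRep W p) (cycSubgroup p m r) →ₗ[ℤ_[p]] ℚ_[p] ⊗[ℚ] CyclotomicField (cycLevel p m r) ℚ)
        (c d₁ a : ℤ) (A : ℕ) (d' : ℤ)
        (z : ∀ (m : ℕ) (r : (cyclotomicLevelsRat p (badPlaces c d₁ A N)).Ideals),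
          H1 (tateRep W p) ((cyclotomicLevelsRat p (badPlaces c d₁ A N)).level m r.1))
        (x : ∀ (m : ℕ) (r : (cyclotomicLevelsRat p (badPlaces c d₁ A N)).Ideals),
          CyclotomicField (cycLevel p m r.1) ℚ)
        (y : I.H) (perRatio : ℚ),
        q ≠ 0 → ZetaBody W p f ι ((q : ℚ) : ℝ) Λ c d₁ a A z x →
        (∀ n : ℕ, I.proj n y =
          levelToLayer W p hK hp (badPlaces c d₁ A N) n
            (z (n + 1) (cyclotomicLevelsRat p (badPlaces c d₁ A N)).idealOne)) →
        0 < A → Int.gcd c (6 * p * A) = 1 → Int.gcd d₁ (6 * p * N) = 1 → (d₁ : ℤ) * d' ≡ 1 [ZMOD (A : ℤ)] →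
        ratCuspFactor f true c d₁ a A d' ≠ 0 → perRatio ≠ 0 →
        plusPeriod f = ((perRatio : ℚ) : ℝ) * W.realPeriodRat →
      ∀ (ι' : PadicAlgCl p ≃+* ℂ)
        (κ : ZpExtension L p) (γ' : absoluteGaloisGroup L) (ΩK : ℂ) (Ωp : (unrIntegers p)ˣ) (Λf : UnrSeries p),
        κ.IsAnticyclotomic → κ.IsTopGenerator γ' → ΩK ≠ 0 →
        IsBDPLFunction ι' (X11b.primeOfEmbeddingDatum p ι' w₀.embedding) κ γ' Dt.f ΩK
          ((Ωp : unrIntegers p) : ℂ_[p]) Λf →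
      ∀ (X : ℂ_[p]), Λf.HasValueAt 0 X →
      ∀ σ : ℚ_[p], HasLocPKummerLog W p (bottomClass W p K I y) σ → σ ≠ 0 →
        ‖X‖ = (p : ℝ) ^ (bdvExplicitExponentR p (W.LFunction p) Dt.c s k (congruenceNumber Dt.f) D.modularDegree
            (σ.valuation + padicValRat p (perRatio /
              (q * ratCuspFactor f true c d₁ a A d' * ∏ ℓ ∈ A.primeFactors.erase p, eulerFactorAtOne W N ℓ))) N)

/-! ## §3 The amended A♭-fam text -/

/-- **`AFlatFamStatementR` — the registered A♭-fam text (`AFlatFamStatement` = bstw_door.lean l.782–832) with the Γ₁/Γ₀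
Petersson index booked once**: `− (padicValNat p (Nat.totient N) : ℤ)` inserted right after the Γ₀ pair
`(ord_p r_f − ord_p m_f)` (TOTIENT spelling (α), pen's call 2026-08-31T03:03:23Z).  OPEN; implies the ν-free crux
`KatoValuationIneqNonsplitAtFive` with slack `ν ≥ 0` (`ErratumRoadFiveBstwDoorValuationIneqR`).
[cite: Kato2004Asterisque, Thm. 12.5, p. 229] [cite: BurungaleSkinnerTianWan2024, Thm. 1.1, p. 3] [cite: KingsLoefflerZerbes2017, Thm. 2.7.4] -/
@[conjecture]
def AFlatFamStatementR : Prop :=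
    ∀ (W : WeierstrassCurve ℚ) [W.IsElliptic] [W.IsGloballyMinimal] (p : ℕ) [Fact p.Prime]
      [ContinuousSMul ℤ_[p] (W.tateModule p)] [Module.Free ℤ_[p] (W.tateModule p)]
      [Module.Finite ℤ_[p] (W.tateModule p)] [NeZero (W.conductorNorm ℤ)],
      ClassX11b W p → 5 ≤ p → Surj W p → ¬ W.HasSplitMultiplicativeReductionAtPrime p →
      ∀ (L : Type) [Field L] [NumberField L], IsImaginaryQuadratic L →
        SatisfiesHeegnerHypothesis (W.conductorNorm ℤ) L → SatisfiesHeegnerHypothesis p L →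
        NumberField.discr L < -4 → Odd (NumberField.discr L) →
        (W.quadraticTwist (NumberField.discr L : ℚ)).entireLFunction 1 ≠ 0 →
      ∀ (Dt : ModularParametrizationData W (W.conductorNorm ℤ))
        (Hd : HeegnerDatum (W.conductorNorm ℤ) (NumberField.discr L)) (w₀ : NumberField.InfinitePlace L)
        (PL : (W.baseChange L).toAffine.Point),
        WeierstrassCurve.Affine.Point.map w₀.embedding.toRatAlgHom PL = heegnerPointComplex Dt Hd →
        ¬ (p : ℤ) ∣ Dt.c →
      ∀ (s : ℚ) (k : ℤ),
        (Real.sqrt ((NumberField.discr L).natAbs : ℝ) : ℂ) *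
            (W.quadraticTwist (NumberField.discr L : ℚ)).entireLFunction 1 = (s : ℂ) * (minusPeriod Dt.f : ℂ) →
        (Dt.c : ℝ) * minusPeriod Dt.f = k * W.imaginaryPeriodRat →
      ∀ (W' : WeierstrassCurve ℚ) [W'.IsElliptic] (D : ModularParametrizationData W' (W.conductorNorm ℤ)),
        D.f = Dt.f →
        (∀ (W'' : WeierstrassCurve ℚ) [W''.IsElliptic] (D'' : ModularParametrizationData W'' (W.conductorNorm ℤ)),
            D''.f = D.f → D.modularDegree ≤ D''.modularDegree) →
      ∀ (K : ZpExtension ℚ p) (hK : K.IsCyclotomic) (γ : absoluteGaloisGroup ℚ)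
        (I : IwasawaH1Data W p K γ), K.IsTopGenerator γ →
      ∀ (hp : p ≠ 2) (N : ℕ) [NeZero N] (f : CuspForm (Gamma0 N) 2), IsNewformOf W f →
      ∀ (ι : (n : ℕ) → (CyclotomicField n ℚ →+* ℂ)) (q : ℚ)
        (Λ : ∀ (m : ℕ) (r : Finset (HeightOneSpectrum (𝓞 ℚ))),
          H1 (tateRep W p) (cycSubgroup p m r) →ₗ[ℤ_[p]] ℚ_[p] ⊗[ℚ] CyclotomicField (cycLevel p m r) ℚ)
        (c d₁ a : ℤ) (A : ℕ) (d' : ℤ)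
        (z : ∀ (m : ℕ) (r : (cyclotomicLevelsRat p (badPlaces c d₁ A N)).Ideals),
          H1 (tateRep W p) ((cyclotomicLevelsRat p (badPlaces c d₁ A N)).level m r.1))
        (x : ∀ (m : ℕ) (r : (cyclotomicLevelsRat p (badPlaces c d₁ A N)).Ideals),
          CyclotomicField (cycLevel p m r.1) ℚ)
        (y : I.H) (perRatio : ℚ),
        q ≠ 0 → ZetaBody W p f ι ((q : ℚ) : ℝ) Λ c d₁ a A z x →
        (∀ n : ℕ, I.proj n y =
          levelToLayer W p hK hp (badPlaces c d₁ A N) n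
            (z (n + 1) (cyclotomicLevelsRat p (badPlaces c d₁ A N)).idealOne)) →
        0 < A → Int.gcd c (6 * p * A) = 1 → Int.gcd d₁ (6 * p * N) = 1 → (d₁ : ℤ) * d' ≡ 1 [ZMOD (A : ℤ)] →
        ratCuspFactor f true c d₁ a A d' ≠ 0 → perRatio ≠ 0 →
        plusPeriod f = ((perRatio : ℚ) : ℝ) * W.realPeriodRat →
      ∀ (ι' : PadicAlgCl p ≃+* ℂ)
        (κ : ZpExtension L p) (γ' : absoluteGaloisGroup L) (ΩK : ℂ) (Ωp : (unrIntegers p)ˣ) (Λf : UnrSeries p),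
        κ.IsAnticyclotomic → κ.IsTopGenerator γ' → ΩK ≠ 0 →
        IsBDPLFunction ι' (X11b.primeOfEmbeddingDatum p ι' w₀.embedding) κ γ' Dt.f ΩK
          ((Ωp : unrIntegers p) : ℂ_[p]) Λf →
      ∀ (X : ℂ_[p]), Λf.HasValueAt 0 X →
      ∀ σ : ℚ_[p], HasLocPKummerLog W p (bottomClass W p K I y) σ → σ ≠ 0 →
        ‖X‖ = (p : ℝ) ^ (1 + padicValInt p Dt.c - padicValRat p s - padicValInt p k -
            ((padicValNat p (congruenceNumber Dt.f) : ℤ) - padicValNat p D.modularDegree) -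
            (padicValNat p (Nat.totient N) : ℤ) -
            (σ.valuation + padicValRat p (perRatio /
              (q * ratCuspFactor f true c d₁ a A d' * ∏ ℓ ∈ A.primeFactors.erase p, eulerFactorAtOne W N ℓ))))

end Summit.BirchSwinnertonDyer.BirchSwinnertonDyer.Theorems.ErratumRoadFiveBdvCalibrationSplitR

end
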